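import Mathlib
import Literature.MathematicalPhysics.QuantumFieldTheory.MagnenRivasseauSeneor1993.MRS93LargeFieldGradient
import Literature.MathematicalPhysics.QuantumFieldTheory.MagnenRivasseauSeneor1993.MRS93NestedLattices
import HarnessLib

/-!
# Magnen–Rivasseau–Sénéor, *Construction of YM₄ with an infrared cutoff* (CMP 155, 1993), §II.B p.335/p.339 —
# THE FINITE SET 𝐃 OF BOXES OF THE UNIT TORUS and (II.35) AS A FINITE SUM: the boxes of each anisotropic lattice
# `𝐃_{i,α}` in the fundamental domain of `Λ = ℝ⁴/ℤ⁴`, their number `M^{α}·M^{3i}`, the union `𝐃` over 𝐏 as a `Finset`,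
# `|𝐃| = Σ_{(i,α)∈𝐏} M^{α}M^{3i}`, every lattice box an integer translate of exactly one torus box (so the printed box
# functionals `E_Δ`, `H_Δ` of any box are those of its representative), and (II.35) summed over THIS `𝐃`: `4^{|𝐃|}` terms

elementary counting + bookkeeping of printed definitions with citation tags; nothing here is a claim about the Yang–Mills mass
gap, about continuum Yang–Mills on `T⁴` without infrared cutoff, or about the Clay problem — and nothing of
Magnen–Rivasseau–Sénéor's expansions or estimates is asserted or formalised

**Citation header (reproduction of PUBLISHED work).** J. Magnen, V. Rivasseau, R. Sénéor, *Construction of YM₄ with an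
infrared cutoff*, Commun. Math. Phys. **155** (1993) 325–383 [MagnenRivasseauSeneor1993], §II.A p.328 tl.4–13, §II.B p.335, p.339. Loci
`p.NNN tl.nn` = journal page and text-layer line of the held scan `paper:magnen1993-cmp155-mrs-ym4-infrared-cutoff`. Cell
pub-balaban-gaps (YM blitz, track G3), seat mrs-lit-1 (statement layer), gen 18; companion record
`run/shared/lean/pub/pub-balaban-gaps/g3/MRS-AS-PRINTED.md`. Sibling modules used BY NAME, nothing re-typed:
`…MRS93NestedLattices` (mrs-lit-2, file 46: `NestedLattices.fineLabels` — the boxes of `𝐃_{i,α}` inside a box of `𝐃_{i′,α′}` —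
with `card_fineLabels`, `mem_fineLabels_iff`, `boxSide_coarse_eq`, `biUnion_fine_boxes_eq`, here at `i′ = α′ = 0`, the UNIT
lattice), `…MRS93LargeFieldGradient` / `…MRS93LargeFieldFunctionals` / `…MRS93LargeFieldRegions` (this seat, gens 17–18:
`BoxLabel`, `chiLFR`, `card_outcomes`, `EprintedPar`, `HprintedPar`, `Eprinted_corner_add`, `HprintedPar_corner_add`,
`indexPairs`, (II.35) `lintegral_ymFactor_muZero_eq_sum_LFR_parEH`), `…MRS93PhaseCells` (gen 0: `anisoBox`, `boxSide`).

**What the paper prints (verbatim).** p.328 tl.4–7: *«We consider the pure Yang-Mills theory with an infrared cutoff, which we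
never try to lift. This cutoff may be imposed on the propagator, or we could consider the theory on a finite volume with some
boundary conditions, or on the sphere S⁴, the torus Λ = ℝ⁴/ℤ⁴ or another compact Riemannian fourdimensional manifold.»*; p.335 tl.16–19: *«We introduce also anisotropic lattices 𝐃_{i,α} for (i, α) ∈ 𝐏. The union of
these lattices is called 𝐃. 𝐃_{i,α} is the lattice of boxes of side M^{−i} in the directions 1, 2, 3 and of side M^{−α} in
the direction 0. It is convenient to take M an integer and these boxes as refinements of a fixed lattice at the unit scale.»*;
p.335 tl.20: *«In each box Δ ∈ 𝐃 we write the expansion»* (II.25); p.337 tl.11: *«In every box of 𝐃 we write»* (II.29a);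
(II.35) p.339 tl.11–14 (quoted in `…MRS93LargeFieldRegions`).

**What is typed here (0 `sorry`, 0 new named facts; every theorem kernel-checked).** The earlier leaves take the box set `𝓓`
of (II.35) as an explicit `Finset` (READING (β) of `…MRS93LargeFieldRegions`: «finitely many boxes (finite ρ, unit torus)»).
This leaf DISCHARGES that reading:
* §1 **`unitCellLabels M i α`** `:= NestedLattices.fineLabels M i 0 α 0 0` — the labels of the boxes of `𝐃_{i,α}` lying in
  the unit cell `[0,1)⁴` (= the box of the unit lattice `𝐃_{0,0}` with corner `0`; `anisoBox_unit` identifies it), i.e. a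
  fundamental domain of `Λ = ℝ⁴/ℤ⁴`; `mem_unitCellLabels_iff` (`0 ≤ k_μ < M^{α}` resp. `M^{i}`), **`card_unitCellLabels`**
  `= M^{α}·(M^{i})³`, `iUnion_unitCell_boxes` (they tile the unit cell, mrs-lit-2's `biUnion_fine_boxes_eq`).
* §2 **`torusBoxes M Jset : Finset BoxLabel`** — 𝐃 ON THE TORUS: the union over the slice pairs `(i, α) ∈ Jset` (𝐏) of the
  unit-cell boxes; `mem_torusBoxes_iff`; **`card_torusBoxes`** `= Σ_{(i,α)∈Jset} M^{α}·(M^{i})³` — FINITE because the volume is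
  finite (the infrared cutoff, «which we never try to lift») and 𝐏 is finite (the ultraviolet cutoff `ρ`); `torusBoxesPar` with
  𝐏 = `indexPairs N ρ₁`.
* §3 **`exists_unitCell_rep`**: every box `(i, α, k)` of the INFINITE lattice `𝐃_{i,α} ⊆ ℝ⁴` (`0 ≤ α`) is the translate, by a
  lattice period (an integer vector `v ∈ ℤ⁴`), of a unit-cell box `(i, α, k₀)` — the integer quotients `k_μ / r_μ`
  label the unit cube containing the box (the construction of mrs-lit-2's `existsUnique_coarse_box`, at the unit lattice); `unitCell_rep_unique` (the representative is unique). Hence, by the torus periodicity of the printed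
  functionals (gen 17's `Eprinted_corner_add`, gen 18's `HprintedPar_corner_add`): **`EprintedPar_eq_rep`**, **`HprintedPar_eq_rep`**
  — `E_Δ(A)` and `H_Δ(A)` of any lattice box equal those of its torus representative: nothing is lost by summing (II.35) over
  `torusBoxes` only.
* §4 **`lintegral_ymFactor_muZero_eq_sum_LFR_torus`**: (II.35) with `𝓓 = torusBoxes par.M 𝐏`, `E_Δ`, `H_Δ` the printed
  functionals and every symbol from `Parameters` (only the powers `P_i`, `P_{1,i}`, the bottom indices `N_i` and `ρ₁` remain
  explicit data); **`card_outcomes_torus`**: the sum «Σ_LFR» has exactly `4^{Σ_{(i,α)∈𝐏} M^{α}(M^{i})³}` terms.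

**Readings (declared).** (β′) the boxes of the torus are represented by the boxes of `ℝ⁴` in the fundamental domain `[0,1)⁴`
(any other fundamental domain gives the same functionals by §3); (ι) of `…MRS93LargeFieldFunctionals` (time labels `α ∈ ℤ`,
nonnegative on 𝐏) inherited — §3 assumes `0 ≤ α` (a box of side `M^{−α} > 1` would not fit in the unit cell).

**What is NOT claimed or typed.** Which outcome the expansion selects; anything of Lemma II.1 or Sects. III–VIII; that (II.35) is
a finite MEASURE («still formal», p.332 tl.21, inherited). MRS work at FIXED INFRARED CUTOFF (p.328 tl.4–7) — here that is
exactly what makes `𝐃` finite; nothing bears on infinite volume or a mass gap.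
-/

noncomputable section

open MeasureTheory Set Finset

namespace Literature.MathematicalPhysics.QuantumFieldTheory.MagnenRivasseauSeneor1993

namespace LargeFieldRegion

open Ansatz MainStatement PositionSpace NestedLattices

/-! ## §1 The boxes of `𝐃_{i,α}` in the unit cell `[0,1)⁴` (a fundamental domain of `Λ = ℝ⁴/ℤ⁴`) -/

/-- The refinement ratio of `𝐃_{i,α}` relative to the UNIT lattice `𝐃_{0,0}`: `M^{α}` in the direction 0, `M^{i}` in the
directions 1, 2, 3 (mrs-lit-2's `NestedLattices.ratio` at `i′ = α′ = 0`). [cite: MagnenRivasseauSeneor1993, §II.B p.335 tl.16–19] -/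
theorem ratio_unit (M i : ℕ) (α : ℤ) (μ : Fin 4) :
    ratio M i 0 α 0 μ = if μ = 0 then M ^ α.toNat else M ^ i := by
  unfold ratio
  simp

/-- The unit lattice's box with corner `0` is the unit cell `[0,1)⁴`. [cite: MagnenRivasseauSeneor1993, §II.A p.328 tl.8, §II.B p.335 tl.18–19] -/
theorem anisoBox_unit (M : ℝ) : PhaseCells.anisoBox M 0 0 0 = Set.pi Set.univ fun _ => Set.Ico (0 : ℝ) 1 := by
  unfold PhaseCells.anisoBox PhaseCells.boxSide
  congr 1
  funext μ
  simp

/-- **The labels of the boxes of `𝐃_{i,α}` lying in the unit cell** `[0,1)⁴` — «these boxes as refinements of a fixed lattice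
at the unit scale» (p.335 tl.18–19): mrs-lit-2's `fineLabels` relative to the unit lattice's box with corner `0`.
[cite: MagnenRivasseauSeneor1993, §II.B p.335 tl.16–19, §II.A p.328 tl.8] -/
def unitCellLabels (M i : ℕ) (α : ℤ) : Finset (Fin 4 → ℤ) := fineLabels M i 0 α 0 0

/-- Membership: `k ∈ unitCellLabels ↔ 0 ≤ k_μ < r_μ` for every `μ` (`r_0 = M^{α}`, `r_μ = M^{i}` otherwise).
[cite: MagnenRivasseauSeneor1993, §II.B p.335 tl.16–19] -/
theorem mem_unitCellLabels_iff (M i : ℕ) (α : ℤ) (k : Fin 4 → ℤ) :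
    k ∈ unitCellLabels M i α ↔ ∀ μ, 0 ≤ k μ ∧ k μ < ratio M i 0 α 0 μ := by
  unfold unitCellLabels fineLabels
  rw [Fintype.mem_piFinset]
  simp only [Finset.mem_Ico, Pi.zero_apply, zero_mul, zero_add, one_mul]

/-- Membership = the box lies in the unit cell (`0 < M`, `0 ≤ α`). [cite: MagnenRivasseauSeneor1993, §II.B p.335 tl.16–19] -/
theorem mem_unitCellLabels_iff_subset {M : ℕ} (hM : 0 < M) (i : ℕ) {α : ℤ} (hα : 0 ≤ α) (k : Fin 4 → ℤ) :
    k ∈ unitCellLabels M i α ↔ PhaseCells.anisoBox (M : ℝ) i α k ⊆ Set.pi Set.univ fun _ => Set.Ico (0 : ℝ) 1 := by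
  rw [← anisoBox_unit (M : ℝ)]
  have h := mem_fineLabels_iff hM (Nat.zero_le i) hα k 0
  simpa [unitCellLabels] using h

/-- **The number of boxes of `𝐃_{i,α}` in the unit cell is `M^{α}·(M^{i})³`** (volume `1` / volume `M^{−α}M^{−3i}`).
[cite: MagnenRivasseauSeneor1993, §II.B p.335 tl.16–19] -/
theorem card_unitCellLabels (M i : ℕ) (α : ℤ) : (unitCellLabels M i α).card = M ^ α.toNat * (M ^ i) ^ 3 := by
  unfold unitCellLabels
  rw [card_fineLabels]
  simp

/-- The unit-cell boxes of `𝐃_{i,α}` tile the unit cell (`0 < M`, `0 ≤ α`): «refinements of a fixed lattice at the unit scale».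
[cite: MagnenRivasseauSeneor1993, §II.B p.335 tl.18–19] -/
theorem iUnion_unitCell_boxes {M : ℕ} (hM : 0 < M) (i : ℕ) {α : ℤ} (hα : 0 ≤ α) :
    (⋃ k ∈ unitCellLabels M i α, PhaseCells.anisoBox (M : ℝ) i α k) = Set.pi Set.univ fun _ => Set.Ico (0 : ℝ) 1 := by
  rw [← anisoBox_unit (M : ℝ)]
  exact biUnion_fine_boxes_eq hM (Nat.zero_le i) hα 0

/-! ## §2 `𝐃` ON THE TORUS: a finite set of boxes -/

/-- **`𝐃` on the torus**: the union over the slice pairs `(i, α) ∈ Jset` (𝐏, time labels in `ℤ`) of the unit-cell boxes of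
`𝐃_{i,α}`, as a `Finset BoxLabel` — «The union of these lattices is called 𝐃» (p.335 tl.17), read on `Λ = ℝ⁴/ℤ⁴`.
[cite: MagnenRivasseauSeneor1993, §II.B p.335 tl.16–19, §II.A p.328 tl.4–7] -/
def torusBoxes (M : ℕ) (Jset : Finset (ℕ × ℤ)) : Finset BoxLabel :=
  Jset.biUnion fun j => (unitCellLabels M j.1 j.2).map (Function.Embedding.sectR j (Fin 4 → ℤ))

/-- Membership in `torusBoxes`. [cite: MagnenRivasseauSeneor1993, §II.B p.335 tl.16–19] -/
theorem mem_torusBoxes_iff (M : ℕ) (Jset : Finset (ℕ × ℤ)) (b : BoxLabel) :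
    b ∈ torusBoxes M Jset ↔ b.1 ∈ Jset ∧ b.2 ∈ unitCellLabels M b.1.1 b.1.2 := by
  unfold torusBoxes
  rw [Finset.mem_biUnion]
  constructor
  · rintro ⟨j, hj, hb⟩
    rw [Finset.mem_map] at hb
    obtain ⟨k, hk, rfl⟩ := hb
    exact ⟨hj, hk⟩
  · rintro ⟨hj, hk⟩
    refine ⟨b.1, hj, ?_⟩
    rw [Finset.mem_map]
    exact ⟨b.2, hk, rfl⟩

/-- **`|𝐃| = Σ_{(i,α)∈𝐏} M^{α}·(M^{i})³` on the torus** — a FINITE number: the volume is finite (the infrared cutoff, «which we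
never try to lift», p.328 tl.4–5) and 𝐏 is finite (the ultraviolet cutoff). [cite: MagnenRivasseauSeneor1993, §II.B p.335 tl.16–19, §II.A p.328 tl.4–7] -/
theorem card_torusBoxes (M : ℕ) (Jset : Finset (ℕ × ℤ)) :
    (torusBoxes M Jset).card = ∑ j ∈ Jset, M ^ j.2.toNat * (M ^ j.1) ^ 3 := by
  unfold torusBoxes
  rw [Finset.card_biUnion]
  · exact Finset.sum_congr rfl fun j _ => by rw [Finset.card_map, card_unitCellLabels]
  · intro j _ j' _ hjj'
    exact Finset.disjoint_left.mpr fun b hb hb' => by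
      rw [Finset.mem_map] at hb hb'
      obtain ⟨k, _, rfl⟩ := hb
      obtain ⟨k', _, h⟩ := hb'
      have h' : (j', k') = (j, k) := h
      exact hjj' (Prod.mk.inj h').1.symm

/-- Every torus box lies in the unit cell (`0 < M`, nonnegative time labels).
[cite: MagnenRivasseauSeneor1993, §II.B p.335 tl.16–19] -/
theorem toSet_subset_unitCell_of_mem_torusBoxes {M : ℕ} (hM : 0 < M) {Jset : Finset (ℕ × ℤ)}
    (hJ : ∀ j ∈ Jset, 0 ≤ j.2) {b : BoxLabel} (hb : b ∈ torusBoxes M Jset) :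
    b.toSet (M : ℝ) ⊆ Set.pi Set.univ fun _ => Set.Ico (0 : ℝ) 1 := by
  rw [mem_torusBoxes_iff] at hb
  exact (mem_unitCellLabels_iff_subset hM b.1.1 (hJ _ hb.1) b.2).mp hb.2

/-- The time labels of 𝐏 (`indexPairs`) are nonnegative (they are natural numbers, READING (ι)).
[cite: MagnenRivasseauSeneor1993, §II.B p.334 tl.44–47] -/
theorem indexPairs_snd_nonneg (N : ℕ → ℕ) (ρ₁ : ℕ) : ∀ j ∈ indexPairs N ρ₁, 0 ≤ j.2 := by
  intro j hj
  unfold indexPairs at hj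
  rw [Finset.mem_image] at hj
  obtain ⟨j', _, rfl⟩ := hj
  exact Int.natCast_nonneg _

/-- **`𝐃` on the torus for the pinned carrier**: `M = par.M`, 𝐏 = `indexPairs N ρ₁`. [cite: MagnenRivasseauSeneor1993, §II.B p.335 tl.16–19] -/
def torusBoxesPar (par : Parameters) (N : ℕ → ℕ) (ρ₁ : ℕ) : Finset BoxLabel := torusBoxes par.M (indexPairs N ρ₁)

/-- Its cardinality. [cite: MagnenRivasseauSeneor1993, §II.B p.335 tl.16–19] -/
theorem card_torusBoxesPar (par : Parameters) (N : ℕ → ℕ) (ρ₁ : ℕ) :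
    (torusBoxesPar par N ρ₁).card = ∑ j ∈ indexPairs N ρ₁, par.M ^ j.2.toNat * (par.M ^ j.1) ^ 3 :=
  card_torusBoxes par.M _

/-! ## §3 Every lattice box is an integer translate of exactly one torus box; `E_Δ`, `H_Δ` agree -/

/-- The unit lattice's sides are `1`. [cite: MagnenRivasseauSeneor1993, §II.B p.335 tl.18–19] -/
theorem boxSide_unit (M : ℝ) (μ : Fin 4) : PhaseCells.boxSide M 0 0 μ = 1 := by
  unfold PhaseCells.boxSide
  simp

/-- `r_μ · side_μ = 1`: the refinement ratio times the side of `𝐃_{i,α}` is the unit side (`0 < M`, `0 ≤ α`).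
[cite: MagnenRivasseauSeneor1993, §II.B p.335 tl.16–19] -/
theorem ratio_mul_boxSide {M : ℕ} (hM : 0 < M) (i : ℕ) {α : ℤ} (hα : 0 ≤ α) (μ : Fin 4) :
    (ratio M i 0 α 0 μ : ℝ) * PhaseCells.boxSide (M : ℝ) i α μ = 1 := by
  rw [← boxSide_coarse_eq hM (Nat.zero_le i) hα μ, boxSide_unit]

/-- **Every box of the infinite lattice `𝐃_{i,α} ⊆ ℝ⁴` is an integer translate of a unit-cell box**: for `0 ≤ α` and any corner
label `k ∈ ℤ⁴` there are a unit-cell label `k₀` and `T, v ∈ ℤ⁴` with `k = k₀ + T` and `T_μ · side_μ = v_μ ∈ ℤ` (the box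
`(i, α, k)` is the box `(i, α, k₀)` translated by the lattice period `v`). [cite: MagnenRivasseauSeneor1993, §II.A p.328 tl.8 («Λ = ℝ⁴/ℤ⁴»), §II.B p.335 tl.16–19] -/
theorem exists_unitCell_rep {M : ℕ} (hM : 0 < M) (i : ℕ) {α : ℤ} (hα : 0 ≤ α) (k : Fin 4 → ℤ) :
    ∃ k₀ ∈ unitCellLabels M i α, ∃ T v : Fin 4 → ℤ,
      k = k₀ + T ∧ ∀ μ, (T μ : ℝ) * PhaseCells.boxSide (M : ℝ) i α μ = v μ := by
  -- the unit cube containing the box: integer quotients `k_μ / r_μ` direction by direction (as in mrs-lit-2's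
  -- `NestedLattices.existsUnique_coarse_box`)
  have hr : ∀ μ, (0 : ℤ) < ratio M i 0 α 0 μ := fun μ => by
    have : 0 < ratio M i 0 α 0 μ := by unfold ratio; split_ifs <;> exact pow_pos hM _
    exact_mod_cast this
  set k' : Fin 4 → ℤ := fun μ => k μ / (ratio M i 0 α 0 μ : ℤ) with hk'def
  have hk' : ∀ μ, k' μ * ratio M i 0 α 0 μ ≤ k μ ∧ k μ < (k' μ + 1) * ratio M i 0 α 0 μ := fun μ =>
    ⟨Int.ediv_mul_le _ (hr μ).ne', Int.lt_ediv_add_one_mul_self _ (hr μ)⟩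
  refine ⟨fun μ => k μ - k' μ * ratio M i 0 α 0 μ, ?_, fun μ => k' μ * ratio M i 0 α 0 μ, k', ?_, fun μ => ?_⟩
  · rw [mem_unitCellLabels_iff]
    intro μ
    have h := hk' μ
    constructor
    · linarith [h.1]
    · nlinarith [h.2]
  · funext μ
    simp
  · push_cast
    rw [mul_assoc, ratio_mul_boxSide hM i hα μ, mul_one]

/-- The unit-cell representative is UNIQUE: two unit-cell boxes of `𝐃_{i,α}` that differ by a lattice period are equal
(`0 < M`, `0 ≤ α`). [cite: MagnenRivasseauSeneor1993, §II.A p.328 tl.8, §II.B p.335 tl.16–19] -/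
theorem unitCell_rep_unique {M : ℕ} (hM : 0 < M) (i : ℕ) {α : ℤ} (hα : 0 ≤ α) {k₀ k₀' T v : Fin 4 → ℤ}
    (hk₀ : k₀ ∈ unitCellLabels M i α) (hk₀' : k₀' ∈ unitCellLabels M i α) (hT : k₀' = k₀ + T)
    (hv : ∀ μ, (T μ : ℝ) * PhaseCells.boxSide (M : ℝ) i α μ = v μ) : k₀' = k₀ := by
  rw [mem_unitCellLabels_iff] at hk₀ hk₀'
  funext μ
  have hTμ : (T μ : ℝ) = v μ * ratio M i 0 α 0 μ :=
    calc (T μ : ℝ) = (T μ : ℝ) * ((ratio M i 0 α 0 μ : ℝ) * PhaseCells.boxSide (M : ℝ) i α μ) := by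
            rw [ratio_mul_boxSide hM i hα μ, mul_one]
      _ = (T μ : ℝ) * PhaseCells.boxSide (M : ℝ) i α μ * (ratio M i 0 α 0 μ : ℝ) := by ring
      _ = v μ * ratio M i 0 α 0 μ := by rw [hv μ]
  have hTint : T μ = v μ * ratio M i 0 α 0 μ := by exact_mod_cast hTμ
  have hr : (0 : ℤ) < ratio M i 0 α 0 μ := by
    have : 0 < ratio M i 0 α 0 μ := by
      unfold ratio; split_ifs <;> exact pow_pos hM _
    exact_mod_cast this
  have e : k₀' μ = k₀ μ + v μ * ratio M i 0 α 0 μ := by rw [hT, Pi.add_apply, hTint]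
  have h0 := hk₀ μ
  have h0' := hk₀' μ
  -- `0 ≤ k₀ μ, k₀' μ < r` and `k₀' μ - k₀ μ = v μ * r` force `v μ = 0`
  have hvz : v μ = 0 := by
    by_contra hne
    rcases lt_or_gt_of_ne hne with hlt | hgt
    · have h1 : v μ ≤ -1 := by omega
      have : v μ * (ratio M i 0 α 0 μ : ℤ) ≤ -1 * (ratio M i 0 α 0 μ : ℤ) :=
        mul_le_mul_of_nonneg_right h1 hr.le
      linarith [h0.1, h0'.1, h0.2, h0'.2]
    · have h1 : 1 ≤ v μ := by omega
      have : 1 * (ratio M i 0 α 0 μ : ℤ) ≤ v μ * (ratio M i 0 α 0 μ : ℤ) :=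
        mul_le_mul_of_nonneg_right h1 hr.le
      linarith [h0.1, h0'.1, h0.2, h0'.2]
  rw [e, hvz, zero_mul, add_zero]

/-- **`H_Δ` of ANY lattice box is `H_Δ` of its torus representative** (carrier's parameters; `0 ≤ α`): by `exists_unitCell_rep`
and the torus periodicity `HprintedPar_corner_add`. [cite: MagnenRivasseauSeneor1993, §II.B (II.29b) p.337, §II.A p.328 tl.8] -/
theorem HprintedPar_eq_rep (par : Parameters) (N : ℕ → ℕ) (S : Finset Momentum) (P₁ : ℕ → ℕ) (ρ₁ : ℕ) (j : ℕ × ℤ)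
    (hα : 0 ≤ j.2) (k : Fin 4 → ℤ) (A : Config) :
    ∃ k₀ ∈ unitCellLabels par.M j.1 j.2,
      HprintedPar par N S P₁ ρ₁ (j, k) A = HprintedPar par N S P₁ ρ₁ (j, k₀) A := by
  have hM : 0 < par.M := lt_of_lt_of_le (by norm_num) par.hM
  obtain ⟨k₀, hk₀, T, v, hk, hT⟩ := exists_unitCell_rep hM j.1 hα k
  refine ⟨k₀, hk₀, ?_⟩
  rw [hk]
  exact HprintedPar_corner_add par N S P₁ ρ₁ j k₀ T v hT A

/-- **`E_Δ` of ANY lattice box is `E_Δ` of its torus representative** (carrier's parameters; `0 ≤ α`): by `exists_unitCell_rep`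
and gen 17's `Eprinted_corner_add`. [cite: MagnenRivasseauSeneor1993, §II.B (II.26) p.335, §II.A p.328 tl.8] -/
theorem EprintedPar_eq_rep (par : Parameters) (N : ℕ → ℕ) (S : Finset Momentum) (P : ℕ → ℕ) (j : ℕ × ℤ) (hα : 0 ≤ j.2)
    (k : Fin 4 → ℤ) (A : Config) :
    ∃ k₀ ∈ unitCellLabels par.M j.1 j.2, EprintedPar par N S P (j, k) A = EprintedPar par N S P (j, k₀) A := by
  have hM : 0 < par.M := lt_of_lt_of_le (by norm_num) par.hM
  have hMr : (0 : ℝ) < (par.M : ℝ) := by exact_mod_cast hM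
  obtain ⟨k₀, hk₀, T, v, hk, hT⟩ := exists_unitCell_rep hM j.1 hα k
  refine ⟨k₀, hk₀, ?_⟩
  rw [hk]
  exact Eprinted_corner_add par N S hMr par.ε₁ (lamT par) P j k₀ T v hT A

/-- Both functionals at once, with the SAME representative, and the representative is a torus box whenever `(i, α) ∈ 𝐏`.
[cite: MagnenRivasseauSeneor1993, §II.B (II.26) p.335, (II.29b) p.337, §II.A p.328 tl.8] -/
theorem exists_rep_mem_torusBoxesPar (par : Parameters) (N : ℕ → ℕ) (S : Finset Momentum) (P P₁ : ℕ → ℕ) (ρ₁ : ℕ)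
    {j : ℕ × ℤ} (hj : j ∈ indexPairs N ρ₁) (k : Fin 4 → ℤ) (A : Config) :
    ∃ k₀, (j, k₀) ∈ torusBoxesPar par N ρ₁ ∧
      EprintedPar par N S P (j, k) A = EprintedPar par N S P (j, k₀) A ∧
      HprintedPar par N S P₁ ρ₁ (j, k) A = HprintedPar par N S P₁ ρ₁ (j, k₀) A := by
  have hM : 0 < par.M := lt_of_lt_of_le (by norm_num) par.hM
  have hMr : (0 : ℝ) < (par.M : ℝ) := by exact_mod_cast hM
  have hα : 0 ≤ j.2 := indexPairs_snd_nonneg N ρ₁ j hj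
  obtain ⟨k₀, hk₀, T, v, hk, hT⟩ := exists_unitCell_rep hM j.1 hα k
  refine ⟨k₀, ?_, ?_, ?_⟩
  · unfold torusBoxesPar
    rw [mem_torusBoxes_iff]
    exact ⟨hj, hk₀⟩
  · rw [hk]; exact Eprinted_corner_add par N S hMr par.ε₁ (lamT par) P j k₀ T v hT A
  · rw [hk]; exact HprintedPar_corner_add par N S P₁ ρ₁ j k₀ T v hT A

/-! ## §4 (II.35) summed over THE boxes of the torus; the number of terms -/

/-- **(II.35) p.339 OVER `𝐃` = THE BOXES OF THE UNIT TORUS**, with `E_Δ` (II.26), `H_Δ` (II.29b) the printed functionals of the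
cut-off field and every symbol (`τ, M, ε₁, λ_i^t, κ_{j′}, k(Δ)`, the admissible pairs AS PRINTED, `dμ_{0,ρ₁}`, the exponential, the
box set) from the carrier's `Parameters`; explicit data left: the powers `P_i`, `P_{1,i}`, the bottom indices `N_i`, `ρ₁`. In
`[0, ∞]`, unconditionally («still formal» inherited). [cite: MagnenRivasseauSeneor1993, §II.B (II.35) p.339 tl.11–14 with p.335 tl.16–20, (II.26), (II.29b) p.337, (II.18) p.332 tl.16–21] -/
theorem lintegral_ymFactor_muZero_eq_sum_LFR_torus (par : Parameters) (N : ℕ → ℕ) (S : Finset Momentum) (lam : ℝ)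
    (ρ₁ : ℕ) (P P₁ : ℕ → ℕ) :
    ∫⁻ A, ENNReal.ofReal (ymFactor S par lam ρ₁ A) ∂(muZero par ρ₁) =
      ∑ D₁ ∈ (torusBoxesPar par N ρ₁).powerset, ∑ D₂ ∈ (torusBoxesPar par N ρ₁).powerset,
        ∫⁻ A, ENNReal.ofReal (chiLFR par.τ (torusBoxesPar par N ρ₁) (EprintedPar par N S P) (HprintedPar par N S P₁ ρ₁)
          D₁ D₂ A * ymFactor S par lam ρ₁ A) ∂(muZero par ρ₁) :=
  lintegral_ymFactor_muZero_eq_sum_LFR_parEH par N S lam ρ₁ P P₁ _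

/-- **The number of terms of «Σ_LFR» in (II.35) on the torus is `4^{|𝐃|} = 4^{Σ_{(i,α)∈𝐏} M^{α}(M^{i})³}`** (one outcome = one of
four choices per box; gen 17's `card_outcomes`). [cite: MagnenRivasseauSeneor1993, §II.B (II.25) p.335, (II.29a) p.337, (II.35) p.339, p.335 tl.16–19] -/
theorem card_outcomes_torus (par : Parameters) (N : ℕ → ℕ) (ρ₁ : ℕ) :
    ((torusBoxesPar par N ρ₁).powerset ×ˢ (torusBoxesPar par N ρ₁).powerset).card =
      4 ^ ∑ j ∈ indexPairs N ρ₁, par.M ^ j.2.toNat * (par.M ^ j.1) ^ 3 := by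
  rw [card_outcomes, card_torusBoxesPar]

/-- The weights over the torus boxes still resolve the identity: `χ_LFR(A) ∈ [0,1]`, `Σ_LFR χ_LFR(A) = 1` for every cut-off `A`.
[cite: MagnenRivasseauSeneor1993, §II.B (II.35) p.339] -/
theorem chiLFR_torus_mem_Icc (par : Parameters) (N : ℕ → ℕ) (S : Finset Momentum) (P P₁ : ℕ → ℕ) (ρ₁ : ℕ)
    (D₁ D₂ : Finset BoxLabel) (A : Config) :
    chiLFR par.τ (torusBoxesPar par N ρ₁) (EprintedPar par N S P) (HprintedPar par N S P₁ ρ₁) D₁ D₂ A ∈ Set.Icc (0 : ℝ) 1 ∧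
      ∑ D₁' ∈ (torusBoxesPar par N ρ₁).powerset, ∑ D₂' ∈ (torusBoxesPar par N ρ₁).powerset,
        chiLFR par.τ (torusBoxesPar par N ρ₁) (EprintedPar par N S P) (HprintedPar par N S P₁ ρ₁) D₁' D₂' A = 1 :=
  chiLFR_parEH_mem_Icc par N S P P₁ ρ₁ _ D₁ D₂ A

end LargeFieldRegion

end Literature.MathematicalPhysics.QuantumFieldTheory.MagnenRivasseauSeneor1993
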